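import Summits.AtomisticToContinuum.Crystallization.Theorems.ChargedEnergyGap.Negative.BlocksBound
import Summits.AtomisticToContinuum.Crystallization.Theorems.ChargedEnergyGap.Negative.Periodisation

/-!
# Route `BrittleRungDescent`, item `MieRung` (stmt-AtomisticToContinuum-10946): the energetic
# conjunct for a GENERAL Lennard-Jones-like pair potential, I — periodic configurations

Support file for the milestone `MieRung` (`∃ q₀, ∀ q ≥ q₀, HasPeriodicGroundStateEnergy
(miePotential q) 3 ∧ IsCrystallizing (miePotential q) 3`).  The tree proves, for the single
potential `lennardJones`, that the Blanc–Lewin form of crystallization (`IsCrystallizing`) already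
implies the energetic form (`HasPeriodicGroundStateEnergy`)
(`KeplerBoundLocalLimit.hasPeriodicGroundStateEnergy_of_isCrystallizing`), through the files
`ChargedEnergyGap/Negative/Blocks*`, `…/Periodisation` and `ThreeConeCertificateKeplerBoundLocLim*`,
all of which hard-code `lennardJones`.  This series re-runs that argument for an ARBITRARY pair
potential `V : ℝ → ℝ` subject to the following "Lennard-Jones-like" hypotheses, each of which holds
for every rung `miePotential q`, `q ≥ 6`, of the Mie ladder (part VI):

* `hV0 : V 0 = 0` (Lean's junk value at coincident points; it makes double sums equal `2 𝓔`);
* `hfar : ∀ r, 1 ≤ r → V r ≤ 0` (attraction beyond the equilibrium distance);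
* `h6 : ∀ r, 0 < r → -(A * r⁻¹ ^ 6) ≤ V r` with `0 ≤ A` (an inverse-sixth-power floor: tails);
* `hstab : ∀ N (x : Fin N → ℝ³), Injective x → -(C * N) ≤ 𝓔_V(x)` (stability).

This part I (periodic side; reusing the block and periodisation CONSTRUCTIONS of
`ChargedEnergyGap/Negative`, which do not depend on the potential):

* `summable_dist` — `y ↦ V(|x − y|)` is summable over the points `y ≠ x` of every periodic
  configuration of `ℝ³` (so `energyPerParticle V` carries no junk value);
* `energyPerParticle_periodise_le`, `card_mul_iInf_le_interactionEnergy` — periodising a finite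
  configuration: `e_V(periodisation of x) ≤ 𝓔_V(x)/N`, hence `N · e_* ≤ 𝓔_V(x)` with
  `e_* = ⨅_Q e_V(Q)` once the range is bounded below;
* `two_mul_energy_block_eq`, `energyPerParticle_ge_tail`, `neg_le_energyPerParticle`,
  `bddBelow_energyPerParticle`, `iInf_le_energyPerParticle` — blocks and finite stability give
  `e_V(Q) ≥ −C` for every periodic `Q`;
* `exists_block_energy_le` — blocks are trial states: `𝓔_V(block_K) ≤ #block · (e_V(Q) + ε)`.

All `[folklore]` (Blanc–Lewin 2015, §1.3 and §2.1).
-/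

noncomputable section

namespace Summit.AtomisticToContinuum.Crystallization.Theorems.MieRungEnergetic

open Literature.MathematicalPhysics.StatisticalMechanics
open Summit.AtomisticToContinuum.Crystallization.Theorems.ChargedEnergyGapNegative
open Summit.AtomisticToContinuum.Crystallization.Theorems.ChargedEnergyGapNegative.Blocks
open scoped BigOperators

variable {V : ℝ → ℝ} {A C : ℝ}

/-! ### Summability of the lattice sums -/

/-- If `V ≤ 0` on `[1, ∞)` and `-A r⁻⁶ ≤ V(r)` (`A ≥ 0`), then `|V(r)| ≤ A r⁻⁶` for `r ≥ 1`.
[folklore] -/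
theorem abs_le_six (hfar : ∀ r, 1 ≤ r → V r ≤ 0) (h6 : ∀ r, 0 < r → -(A * r⁻¹ ^ 6) ≤ V r)
    (hA : 0 ≤ A) {r : ℝ} (hr : 1 ≤ r) : |V r| ≤ A * six r := by
  rw [abs_le]
  refine ⟨?_, (hfar r hr).trans (mul_nonneg hA (six_nonneg r))⟩
  have := h6 r (by linarith)
  simpa [six] using this

/-- **Lattice sums are summable.** For `V ≤ 0` on `[1, ∞)` with an inverse-sixth-power floor,
`y ↦ V(|x − y|)` is summable over the points `y ≠ x` of every periodic configuration of `ℝ³`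
(finitely many points within distance `1`; `|V| ≤ A r⁻⁶` beyond, summable in `d = 3`).
[folklore] -/
theorem summable_dist (hfar : ∀ r, 1 ≤ r → V r ≤ 0) (h6 : ∀ r, 0 < r → -(A * r⁻¹ ^ 6) ≤ V r)
    (hA : 0 ≤ A) (Q : PeriodicConfiguration 3) (x : E3) :
    Summable fun y : {y : E3 // y ∈ Q.points ∧ y ≠ x} => V (dist x y.1) := by
  have hg : Summable fun y : {y : E3 // y ∈ Q.points ∧ y ≠ x} => A * six (dist x y.1) :=
    (summable_six Q x).mul_left A
  refine Summable.of_norm_bounded_eventually hg ?_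
  have hfin : (Metric.ball x 1 ∩ Q.points).Finite := Q.finite_inter_points Metric.isBounded_ball
  have hfin' : {y : {y : E3 // y ∈ Q.points ∧ y ≠ x} | dist x y.1 < 1}.Finite := by
    refine (hfin.preimage Subtype.val_injective.injOn).subset ?_
    intro y hy
    exact ⟨Metric.mem_ball'.2 hy, y.2.1⟩
  refine Filter.eventually_cofinite.2 (hfin'.subset ?_)
  intro y hy
  by_contra h1
  have h1' : 1 ≤ dist x y.1 := not_lt.1 h1
  exact hy (by rw [Real.norm_eq_abs]; exact abs_le_six hfar h6 hA h1')

/-! ### Periodisation: `N · e_* ≤ 𝓔_V(x)` -/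

section Periodise

variable {N : ℕ} {x : Fin N → E3}

/-- The lattice sum at `xᵢ` over the periodisation of `x` is at most the finite site energy
`∑_{k ≠ i} V(|xᵢ − x_k|)`: the remaining terms are at distances `≥ 2`, where `V ≤ 0`.
[folklore] -/
theorem tsum_periodise_le_siteEnergy (hfar : ∀ r, 1 ≤ r → V r ≤ 0)
    (h6 : ∀ r, 0 < r → -(A * r⁻¹ ^ 6) ≤ V r) (hA : 0 ≤ A) (hx : Function.Injective x)
    (c : ℝˣ) (hc : period x ≤ (c : ℝ)) (hN : 0 < N) (i : Fin N) :
    (∑' y : {y : E3 // y ∈ (periodise x c hc hN).points ∧ y ≠ x i}, V (dist (x i) y.1)) ≤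
      siteEnergy V x i := by
  set P := periodise x c hc hN with hP
  set f : {y : E3 // y ∈ P.points ∧ y ≠ x i} → ℝ := fun y => V (dist (x i) y.1) with hf
  have hsum : Summable f := summable_dist hfar h6 hA P (x i)
  have hmem : ∀ k : {k // k ∈ Finset.univ.erase i}, x k.1 ∈ P.points ∧ x k.1 ≠ x i := fun k =>
    ⟨P.mem_points_of_mem_motif (by
        rw [hP, motif_periodise]; exact Finset.mem_image_of_mem x (Finset.mem_univ _)),
      hx.ne (Finset.ne_of_mem_erase k.2)⟩
  set emb : {k // k ∈ Finset.univ.erase i} → {y : E3 // y ∈ P.points ∧ y ≠ x i} :=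
    fun k => ⟨x k.1, hmem k⟩ with hemb
  have hinj : Function.Injective emb := by
    intro k l hkl
    have h1 : x k.1 = x l.1 := congrArg Subtype.val hkl
    exact Subtype.ext (hx h1)
  set s₀ : Finset {y : E3 // y ∈ P.points ∧ y ≠ x i} := (Finset.univ.erase i).attach.image emb
    with hs₀
  have hsign : ∀ y ∉ s₀, 0 ≤ (fun b => -f b) y := by
    intro y hy
    have hfar' : ∀ j, y.1 ≠ x j := by
      intro j hj
      by_cases hji : j = i
      · exact y.2.2 (hji ▸ hj)
      · exact hy (Finset.mem_image.2 ⟨⟨j, Finset.mem_erase.2 ⟨hji, Finset.mem_univ j⟩⟩,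
          Finset.mem_attach _ _, Subtype.ext hj.symm⟩)
    have h1 := two_le_dist_of_mem_points x c hc hN i y.2.1 hfar'
    simp only [hf, neg_nonneg]
    exact hfar _ (by linarith)
  have h1 := sum_le_hasSum s₀ hsign hsum.hasSum.neg
  have h2 : ∑ y ∈ s₀, f y = siteEnergy V x i := by
    rw [hs₀, Finset.sum_image fun k _ l _ h => hinj h]
    exact Finset.sum_attach (Finset.univ.erase i) fun k => V (dist (x i) (x k))
  rw [Finset.sum_neg_distrib, h2] at h1
  linarith

/-- Hence `e_V(periodisation of x) ≤ 𝓔_V(x)/N`. [folklore] -/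
theorem energyPerParticle_periodise_le (hfar : ∀ r, 1 ≤ r → V r ≤ 0)
    (h6 : ∀ r, 0 < r → -(A * r⁻¹ ^ 6) ≤ V r) (hA : 0 ≤ A) (hx : Function.Injective x)
    (c : ℝˣ) (hc : period x ≤ (c : ℝ)) (hN : 0 < N) :
    (periodise x c hc hN).energyPerParticle V ≤ interactionEnergy V x / N := by
  have hcard : (periodise x c hc hN).motif.card = N := by
    rw [motif_periodise, Finset.card_image_of_injective _ hx, Finset.card_univ, Fintype.card_fin]
  have hNr : (0 : ℝ) < N := by exact_mod_cast hN
  unfold PeriodicConfiguration.energyPerParticle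
  rw [hcard]
  have hsum : ∑ z ∈ (periodise x c hc hN).motif,
      ∑' y : {y : E3 // y ∈ (periodise x c hc hN).points ∧ y ≠ z}, V (dist z y.1) ≤
        ∑ i, siteEnergy V x i := by
    rw [motif_periodise, Finset.sum_image fun i _ j _ h => hx h]
    exact Finset.sum_le_sum fun i _ => tsum_periodise_le_siteEnergy hfar h6 hA hx c hc hN i
  rw [← two_mul_interactionEnergy] at hsum
  calc (2 * (N : ℝ))⁻¹ * ∑ z ∈ (periodise x c hc hN).motif,
        ∑' y : {y : E3 // y ∈ (periodise x c hc hN).points ∧ y ≠ z}, V (dist z y.1)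
      ≤ (2 * (N : ℝ))⁻¹ * (2 * interactionEnergy V x) :=
        mul_le_mul_of_nonneg_left hsum (by positivity)
    _ = interactionEnergy V x / N := by
        field_simp

/-- **`N · e_* ≤ 𝓔_V(x)` for every injective configuration**, `e_* = ⨅_Q e_V(Q)`, as soon as the
periodic energies per particle are bounded below (so that `⨅` is a genuine infimum). [folklore] -/
theorem card_mul_iInf_le_interactionEnergy (hfar : ∀ r, 1 ≤ r → V r ≤ 0)
    (h6 : ∀ r, 0 < r → -(A * r⁻¹ ^ 6) ≤ V r) (hA : 0 ≤ A)
    (hB : BddBelow (Set.range fun Q : PeriodicConfiguration 3 => Q.energyPerParticle V))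
    (hx : Function.Injective x) :
    (N : ℝ) * (⨅ Q : PeriodicConfiguration 3, Q.energyPerParticle V) ≤ interactionEnergy V x := by
  rcases Nat.eq_zero_or_pos N with rfl | hN
  · simp [interactionEnergy]
  · have h1 : (⨅ Q : PeriodicConfiguration 3, Q.energyPerParticle V) ≤
        (periodise x (periodUnit x) le_rfl hN).energyPerParticle V := ciInf_le hB _
    have h2 := energyPerParticle_periodise_le hfar h6 hA hx (periodUnit x) le_rfl hN
    have hNr : (0 : ℝ) < N := by exact_mod_cast hN
    have := h1.trans h2
    rwa [le_div_iff₀ hNr, mul_comm] at this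

end Periodise

/-! ### Blocks of a periodic configuration -/

section Blocks

variable (Q : PeriodicConfiguration 3) (K : ℕ)

/-- **Splitting** a site sum at a block point into block part and tail (summable lattice sums).
[folklore] -/
theorem siteSum_eq_sum_add_tail (hfar : ∀ r, 1 ≤ r → V r ≤ 0)
    (h6 : ∀ r, 0 < r → -(A * r⁻¹ ^ 6) ≤ V r) (hA : 0 ≤ A) (u : BIdx Q K) :
    siteSum Q V (bpt Q K u) =
      ∑ v ∈ Finset.univ.erase u, V (dist (bpt Q K u) (bpt Q K v)) + tail Q K V u := by
  unfold siteSum tail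
  rw [← sum_blockOthers, (summable_dist hfar h6 hA Q (bpt Q K u)).sum_add_tsum_compl]

/-- Twice the energy of the block is the double sum over block indices (diagonal terms vanish
by `V 0 = 0`). [folklore] -/
theorem two_mul_energy_blockConfig (hV0 : V 0 = 0) :
    2 * interactionEnergy V (blockConfig Q K) =
      ∑ u : BIdx Q K, ∑ v : BIdx Q K, V (dist (bpt Q K u) (bpt Q K v)) := by
  rw [two_mul_interactionEnergy_eq_sum_sum V hV0]
  simp only [blockConfig_apply]
  exact ((Fintype.equivFin (BIdx Q K)).symm.sum_comp (fun p => ∑ b,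
    V (dist (bpt Q K p) (bpt Q K ((Fintype.equivFin (BIdx Q K)).symm b))))).trans
    (Finset.sum_congr rfl fun p _ => (Fintype.equivFin (BIdx Q K)).symm.sum_comp
      (fun q => V (dist (bpt Q K p) (bpt Q K q))))

/-- The row sums are site sums minus tails. [folklore] -/
theorem sum_row_eq (hV0 : V 0 = 0) (hfar : ∀ r, 1 ≤ r → V r ≤ 0)
    (h6 : ∀ r, 0 < r → -(A * r⁻¹ ^ 6) ≤ V r) (hA : 0 ≤ A) (u : BIdx Q K) :
    ∑ v : BIdx Q K, V (dist (bpt Q K u) (bpt Q K v)) = siteSum Q V u.1 - tail Q K V u := by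
  rw [← siteSum_bpt Q K, siteSum_eq_sum_add_tail Q K hfar h6 hA,
    ← Finset.add_sum_erase _ _ (Finset.mem_univ u), dist_self, hV0]
  ring

/-- **The energy identity of a block**: `2·𝓔_V(block_K) = K³ · 2#F · e_V(Q) − Σ_u tail(u)`.
[folklore] -/
theorem two_mul_energy_block_eq (hV0 : V 0 = 0) (hfar : ∀ r, 1 ≤ r → V r ≤ 0)
    (h6 : ∀ r, 0 < r → -(A * r⁻¹ ^ 6) ≤ V r) (hA : 0 ≤ A) :
    2 * interactionEnergy V (blockConfig Q K) =
      (K : ℝ) ^ 3 * (2 * Q.motif.card * Q.energyPerParticle V) -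
        ∑ u : BIdx Q K, tail Q K V u := by
  rw [two_mul_energy_blockConfig Q K hV0,
    Finset.sum_congr rfl fun u _ => sum_row_eq Q K hV0 hfar h6 hA u,
    Finset.sum_sub_distrib, ← sum_siteSum_eq, Fintype.sum_prod_type]
  simp only [Finset.sum_const, Finset.card_univ, Fintype.card_fun, Fintype.card_fin, nsmul_eq_mul]
  rw [← Finset.mul_sum, Finset.sum_coe_sort Q.motif (siteSum Q V)]
  push_cast
  ring

/-- **The tail is bounded below by the sixth-power tail**: `tail u ≥ −A · tailSix u`.
[folklore] -/
theorem neg_tailSix_le_tail (hfar : ∀ r, 1 ≤ r → V r ≤ 0)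
    (h6 : ∀ r, 0 < r → -(A * r⁻¹ ^ 6) ≤ V r) (hA : 0 ≤ A) (u : BIdx Q K) :
    -(A * tailSix Q K u) ≤ tail Q K V u := by
  unfold tail tailSix
  rw [← tsum_mul_left, ← tsum_neg]
  refine Summable.tsum_le_tsum (fun q => ?_) ?_ ?_
  · have := h6 _ (dist_pos.2 (Ne.symm q.1.2.2))
    simpa [six] using this
  · exact (((summable_six Q (bpt Q K u)).subtype _).mul_left A).neg
  · exact (summable_dist hfar h6 hA Q (bpt Q K u)).subtype _

/-- **Lower bound on `e_V(Q)` from finite stability**: for `K ≥ 1`,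
`e_V(Q) ≥ −C + (Σ_u tail u)/(2 #F K³)`. [folklore] -/
theorem energyPerParticle_ge_tail (hV0 : V 0 = 0) (hfar : ∀ r, 1 ≤ r → V r ≤ 0)
    (h6 : ∀ r, 0 < r → -(A * r⁻¹ ^ 6) ≤ V r) (hA : 0 ≤ A)
    (hstab : ∀ (n : ℕ) (y : Fin n → E3), Function.Injective y →
      -(C * n) ≤ interactionEnergy V y)
    {K : ℕ} (hK : 0 < K) :
    -C + (∑ u : BIdx Q K, tail Q K V u) / (2 * Q.motif.card * (K : ℝ) ^ 3) ≤
      Q.energyPerParticle V := by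
  have hF : (0 : ℝ) < Q.motif.card := by exact_mod_cast Q.motif_nonempty.card_pos
  have hK' : (0 : ℝ) < (K : ℝ) ^ 3 := by positivity
  have hstab' := hstab _ (blockConfig Q K) (blockConfig_injective Q K)
  have hn : ((Fintype.card (BIdx Q K) : ℕ) : ℝ) = Q.motif.card * (K : ℝ) ^ 3 := by
    exact_mod_cast card_BIdx Q K
  rw [hn] at hstab'
  have hid := two_mul_energy_block_eq Q K hV0 hfar h6 hA
  have hpos : (0 : ℝ) < 2 * Q.motif.card * (K : ℝ) ^ 3 := by positivity
  have h1 : ∑ u : BIdx Q K, tail Q K V u ≤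
      (Q.energyPerParticle V + C) * (2 * Q.motif.card * (K : ℝ) ^ 3) := by
    nlinarith
  have h2 := (div_le_iff₀ hpos).2 h1
  linarith

/-- **Every periodic energy per particle is at least `−C`** (the stability constant).
[folklore] -/
theorem neg_le_energyPerParticle (hV0 : V 0 = 0) (hfar : ∀ r, 1 ≤ r → V r ≤ 0)
    (h6 : ∀ r, 0 < r → -(A * r⁻¹ ^ 6) ≤ V r) (hA : 0 ≤ A)
    (hstab : ∀ (n : ℕ) (y : Fin n → E3), Function.Injective y →
      -(C * n) ≤ interactionEnergy V y) :
    -C ≤ Q.energyPerParticle V := by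
  refine le_of_forall_pos_le_add fun ε hε => ?_
  obtain ⟨K₀, hK₀, hK⟩ := exists_sum_tailSix_le Q (show 0 < ε / (A + 1) by positivity)
  have hF : (0 : ℝ) < Q.motif.card := by exact_mod_cast Q.motif_nonempty.card_pos
  have hsum := hK K₀ le_rfl
  have hge := energyPerParticle_ge_tail Q hV0 hfar h6 hA hstab hK₀
  have hK₀r : (0 : ℝ) < (K₀ : ℝ) ^ 3 := by positivity
  have hpos : (0 : ℝ) < 2 * Q.motif.card * (K₀ : ℝ) ^ 3 := by positivity
  -- tails ≥ −A·tailSix termwise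
  have htail : -(A * ∑ u : BIdx Q K₀, tailSix Q K₀ u) ≤ ∑ u : BIdx Q K₀, tail Q K₀ V u := by
    rw [Finset.mul_sum, ← Finset.sum_neg_distrib]
    exact Finset.sum_le_sum fun u _ => neg_tailSix_le_tail Q K₀ hfar h6 hA u
  have hA1 : A * (ε / (A + 1)) ≤ ε := by
    rw [mul_div_assoc', div_le_iff₀ (by positivity)]
    nlinarith
  have h0 : 0 ≤ ∑ u : BIdx Q K₀, tailSix Q K₀ u := Finset.sum_nonneg fun u _ => tailSix_nonneg Q K₀ u
  have h1 : -(ε * (2 * Q.motif.card * (K₀ : ℝ) ^ 3)) ≤ ∑ u : BIdx Q K₀, tail Q K₀ V u := by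
    have h3 : A * ∑ u : BIdx Q K₀, tailSix Q K₀ u ≤ ε * (2 * Q.motif.card * (K₀ : ℝ) ^ 3) :=
      calc A * ∑ u : BIdx Q K₀, tailSix Q K₀ u
          ≤ A * (ε / (A + 1) * (2 * Q.motif.card * (K₀ : ℝ) ^ 3)) :=
            mul_le_mul_of_nonneg_left hsum hA
        _ = A * (ε / (A + 1)) * (2 * Q.motif.card * (K₀ : ℝ) ^ 3) := by ring
        _ ≤ ε * (2 * Q.motif.card * (K₀ : ℝ) ^ 3) :=
            mul_le_mul_of_nonneg_right hA1 hpos.le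
    linarith
  have h2 : -ε ≤ (∑ u : BIdx Q K₀, tail Q K₀ V u) / (2 * Q.motif.card * (K₀ : ℝ) ^ 3) := by
    rw [le_div_iff₀ hpos]; linarith
  linarith

/-- **Blocks are trial states**: for every `ε > 0`, all large blocks have energy
`𝓔_V(block_K) ≤ #block · (e_V(Q) + ε)`. [folklore] -/
theorem exists_block_energy_le (hV0 : V 0 = 0) (hfar : ∀ r, 1 ≤ r → V r ≤ 0)
    (h6 : ∀ r, 0 < r → -(A * r⁻¹ ^ 6) ≤ V r) (hA : 0 ≤ A) {ε : ℝ} (hε : 0 < ε) :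
    ∃ K₀ : ℕ, 0 < K₀ ∧ ∀ K : ℕ, K₀ ≤ K →
      interactionEnergy V (blockConfig Q K) ≤
        (Fintype.card (BIdx Q K) : ℝ) * (Q.energyPerParticle V + ε) := by
  obtain ⟨K₀, hK₀, hK⟩ := exists_sum_tailSix_le Q (show 0 < ε / (A + 1) by positivity)
  refine ⟨K₀, hK₀, fun K hKK => ?_⟩
  have hF : (0 : ℝ) < Q.motif.card := by exact_mod_cast Q.motif_nonempty.card_pos
  have hsum := hK K hKK
  have hid := two_mul_energy_block_eq Q K hV0 hfar h6 hA
  have htail : -(A * ∑ u : BIdx Q K, tailSix Q K u) ≤ ∑ u : BIdx Q K, tail Q K V u := by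
    rw [Finset.mul_sum, ← Finset.sum_neg_distrib]
    exact Finset.sum_le_sum fun u _ => neg_tailSix_le_tail Q K hfar h6 hA u
  have hn : ((Fintype.card (BIdx Q K) : ℕ) : ℝ) = Q.motif.card * (K : ℝ) ^ 3 := by
    exact_mod_cast card_BIdx Q K
  rw [hn]
  have hKr : (0 : ℝ) ≤ (K : ℝ) ^ 3 := by positivity
  have hpos : (0 : ℝ) ≤ 2 * Q.motif.card * (K : ℝ) ^ 3 := by positivity
  have hA1 : A * (ε / (A + 1)) ≤ ε := by
    rw [mul_div_assoc', div_le_iff₀ (by positivity)]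
    nlinarith
  have h3 : A * ∑ u : BIdx Q K, tailSix Q K u ≤ ε * (2 * Q.motif.card * (K : ℝ) ^ 3) :=
    calc A * ∑ u : BIdx Q K, tailSix Q K u
        ≤ A * (ε / (A + 1) * (2 * Q.motif.card * (K : ℝ) ^ 3)) :=
          mul_le_mul_of_nonneg_left hsum hA
      _ = A * (ε / (A + 1)) * (2 * Q.motif.card * (K : ℝ) ^ 3) := by ring
      _ ≤ ε * (2 * Q.motif.card * (K : ℝ) ^ 3) := mul_le_mul_of_nonneg_right hA1 hpos
  nlinarith

/-- **The periodic energies per particle are bounded below** (by `−C`), so `⨅_Q e_V(Q)` is a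
genuine infimum. [folklore] -/
theorem bddBelow_energyPerParticle (hV0 : V 0 = 0) (hfar : ∀ r, 1 ≤ r → V r ≤ 0)
    (h6 : ∀ r, 0 < r → -(A * r⁻¹ ^ 6) ≤ V r) (hA : 0 ≤ A)
    (hstab : ∀ (n : ℕ) (y : Fin n → E3), Function.Injective y →
      -(C * n) ≤ interactionEnergy V y) :
    BddBelow (Set.range fun Q : PeriodicConfiguration 3 => Q.energyPerParticle V) :=
  ⟨-C, by rintro _ ⟨Q, rfl⟩; exact neg_le_energyPerParticle Q hV0 hfar h6 hA hstab⟩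

/-- Hence `⨅_Q e_V(Q) ≤ e_V(Q)` for every periodic `Q`. [folklore] -/
theorem iInf_le_energyPerParticle (hV0 : V 0 = 0) (hfar : ∀ r, 1 ≤ r → V r ≤ 0)
    (h6 : ∀ r, 0 < r → -(A * r⁻¹ ^ 6) ≤ V r) (hA : 0 ≤ A)
    (hstab : ∀ (n : ℕ) (y : Fin n → E3), Function.Injective y →
      -(C * n) ≤ interactionEnergy V y) :
    (⨅ Q : PeriodicConfiguration 3, Q.energyPerParticle V) ≤ Q.energyPerParticle V :=
  ciInf_le (bddBelow_energyPerParticle hV0 hfar h6 hA hstab) Q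

/-- And `−C ≤ ⨅_Q e_V(Q)`. [folklore] -/
theorem neg_le_iInf_energyPerParticle (hV0 : V 0 = 0) (hfar : ∀ r, 1 ≤ r → V r ≤ 0)
    (h6 : ∀ r, 0 < r → -(A * r⁻¹ ^ 6) ≤ V r) (hA : 0 ≤ A)
    (hstab : ∀ (n : ℕ) (y : Fin n → E3), Function.Injective y →
      -(C * n) ≤ interactionEnergy V y) :
    -C ≤ (⨅ Q : PeriodicConfiguration 3, Q.energyPerParticle V) :=
  le_ciInf fun Q => neg_le_energyPerParticle Q hV0 hfar h6 hA hstab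

end Blocks

end Summit.AtomisticToContinuum.Crystallization.Theorems.MieRungEnergetic

end
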